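import Literature.MathematicalPhysics.QuantumFieldTheory.Balaban1983to89.B5HkPropsTorus
import Literature.MathematicalPhysics.QuantumFieldTheory.Balaban1983to89.B5AverageCurlStokes
import Literature.MathematicalPhysics.QuantumFieldTheory.Balaban1983to89.B5Composition116

/-!
# T⁴ programme, spine node NE2 (U1a), lane P2 — THE VARIATIONAL (RAYLEIGH–RITZ) CONTRACTION OF THE LINEAR BLOCK-SPIN MAP:
# the abstract spine of `t4/skeletons/NE2-t4-ne2-p2.md` (cell `pub-balaban`, `HOME/BINDER-OWNERS.md` row NE2, co-owner #2,
# lineage t4-ne2-p2 gen 9; ROUND-2 skeleton-first mandate)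

HONEST FRAMING (T4-DAG p. 1).  Rung (B)+1 of the cell = existence AND uniqueness of the ε → 0 limit of gauge-invariant
observables on a FIXED finite torus T⁴ — NOT infinite volume, NOT a mass gap, NOT the Clay problem.  Node NE2 = the η-rate of
the LINEAR theory (effective actions / propagators at adjacent lattice spacings) is NOT IN PRINT ([Balaban1984PropagatorsI]–
[Balaban1985BackgroundPropagators] print η-UNIFORM bounds only; cell GAPS G-t4-U1a-1) and is NOT proved in this file.  This
file proves ONLY the lattice-theoretic ALGEBRA of the route (every statement below is about an arbitrary "action" `S : V → ℝ`
bounded below by `0` and arbitrary "averaging" maps `Q`); the analytic leaves that instantiate its hypotheses for Bałaban's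
objects are typed in the sibling module `VariationalLeaves` and are OPEN unless marked there.  HONEST DEPENDENCY (cell,
verbatim): continuum YM on T⁴ ⇐ BetaPertH ∧ nine spine estimates (0/9 proved); BetaPertH ⇐ (D1) ∧ (D4) ∧ CAP+tail; G-an2-4
gates asym, D1 and NE2/3/4.  No `sorry`; axioms ⊆ {propext, Classical.choice, Quot.sound}; nothing printed is a hypothesis.

THE ROUTE IN ONE PARAGRAPH.  [Balaban1984PropagatorsI] p. 26 (before (1.48)) and p. 29 ((1.65)) PRINT that the k-th
effective action is a MINIMUM VALUE: `⟨B, Δ_k B⟩ = min {⟨∂A, ∂A⟩ : Q_k A = B}` («its value on such a configuration is equal to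
a configuration A on T_η minimizing the form ½⟨∂A, ∂A⟩ under the conditions Q_kA = B, R∂*A = 0»; «⟨B, Δ_kB⟩ = ⟨∂H_kB, ∂H_kB⟩.
(1.65)»), and p. 20 ((1.16)–(1.18)) PRINTS the composition law `Q_{k+1} = Q_k ∘ Q` of the averages (tree:
`B5Composition116`; with background [Balaban1985BackgroundPropagators] (3.15)).  Writing `T_Q S (B) := inf {S A : Q A = B}`
(`blockSpin` below), composition gives `Δ_{k+1} = T_{Q_k}(T_Q S_{η/L})` and `Δ_k = T_{Q_k}(S_η)` — the SAME outer map applied to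
two forms on η-lattice fields: the one-step effective action `S¹ := T_Q S_{η/L}` and the Wilson form `S⁰ := S_η`.  The outer map
is MONOTONE (`blockSpin_mono`), so (i) Federbush's «averaging decreases the action» `S_η (Q A′) ≤ S_{η/L}(A′)` ([Federbush1986PhaseCellI]
(0.12); tree, constant 1: `B5AverageCurlStokes.sum_normSq_Fs_QvOp_le`) gives `Δ_k ≤ Δ_{k+1}` EXACTLY (`blockSpin_federbush_lower`),
and (ii) ONE-STEP CONSISTENCY on the k-step minimiser only, `S¹(H_kB) ≤ (1 + ε_k)·S⁰(H_kB)`, gives `Δ_{k+1} ≤ (1 + ε_k)Δ_k`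
(`blockSpin_transfer_upper`).  Hence `0 ≤ Δ_{k+1} − Δ_k ≤ ε_k Δ_k` (`step_sandwich`): the linear block-spin map CONTRACTS the
initial O(1) discrepancy between `S¹` and `S⁰` (lattice-scale fields) to `ε_k` because it evaluates the forms on minimisers
only; `ε_k = C·L^{−2k}` is the product of a ONE-STEP symbol inequality and an L²-regularity bound for the minimiser (leaves
L-ONE, L-REG of the sibling module).  With a background field the same algebra runs with an APPROXIMATE Federbush factor
`(1 + μ_k)` (`step_sandwich_approx`).  Numerics (kit job j086962, d = 2, L = 2): `sup_B ⟨B,(Δ_{k+1}−Δ_k)B⟩/⟨B,Δ_kB⟩ =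
0.778, 0.190, 0.0471` at `k = 1, 2, 3` (`× L^{2k} = 3.11, 3.04, 3.01`), all generalized eigenvalues ≥ 0 (monotonicity), and the
one-step consistency quotient on `H_kB` `× L^{2k} = 3.11, 3.29, 3.21` — the transfer is sharp.
-/

namespace Summit.QuantumFields.BalabanUV.T4Continuum.VariationalTransfer

open Set

variable {V W Z : Type*}

/-! ## §1 The linear block-spin map on forms: `T_Q S (B) = inf {S A : Q A = B}` -/

/-- the fibre of the averaging map `Q` over the coarse datum `B`. [folklore] -/
def fib (Q : V → W) (B : W) : Set V := {A | Q A = B}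

/-- membership in the fibre. [folklore] -/
@[simp] theorem mem_fib {Q : V → W} {B : W} {A : V} : A ∈ fib Q B ↔ Q A = B := Iff.rfl

/-- **the block-spin map on actions**: `blockSpin Q S B = inf {S A : Q A = B}` — for `S = ⟨∂·, ∂·⟩_η` and `Q = Q_k` this is
`⟨B, Δ_k B⟩` by the printed minimum characterisation. [cite: Balaban1984PropagatorsI, p.26 (text before (1.48)) + (1.65) p.29] -/
noncomputable def blockSpin (Q : V → W) (S : V → ℝ) (B : W) : ℝ := sInf (S '' fib Q B)

section basic

variable {Q : V → W} {S S₁ S₂ : V → ℝ} {B : W}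

/-- the image of a fibre under a nonnegative action is bounded below. [folklore] -/
theorem bddBelow_image (hS : ∀ A, 0 ≤ S A) : BddBelow (S '' fib Q B) :=
  ⟨0, by rintro _ ⟨A, -, rfl⟩; exact hS A⟩

/-- the block-spin value is at most the action of any field in the fibre. [folklore] -/
theorem blockSpin_le (hS : ∀ A, 0 ≤ S A) {A : V} (hA : Q A = B) : blockSpin Q S B ≤ S A :=
  csInf_le (bddBelow_image hS) ⟨A, hA, rfl⟩

/-- a lower bound valid on the whole (nonempty) fibre bounds the block-spin value from below. [folklore] -/
theorem le_blockSpin (hne : (fib Q B).Nonempty) {m : ℝ} (hm : ∀ A, Q A = B → m ≤ S A) : m ≤ blockSpin Q S B :=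
  le_csInf (hne.image S) (by rintro _ ⟨A, hA, rfl⟩; exact hm A hA)

/-- the block-spin value of a nonnegative action is nonnegative (on a nonempty fibre). [folklore] -/
theorem blockSpin_nonneg (hne : (fib Q B).Nonempty) (hS : ∀ A, 0 ≤ S A) : 0 ≤ blockSpin Q S B :=
  le_blockSpin hne fun A _ => hS A

/-- the block-spin value of a nonnegative action is nonnegative, unconditionally (empty fibre: `sInf ∅ = 0`). [folklore] -/
theorem blockSpin_nonneg' (hS : ∀ A, 0 ≤ S A) : 0 ≤ blockSpin Q S B := by
  by_cases hne : (fib Q B).Nonempty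
  · exact blockSpin_nonneg hne hS
  · rw [Set.not_nonempty_iff_eq_empty] at hne
    simp [blockSpin, hne]

/-- **MONOTONICITY of the block-spin map in the action**: `S₁ ≤ S₂ ⇒ T_Q S₁ ≤ T_Q S₂`. [folklore] -/
theorem blockSpin_mono (hne : (fib Q B).Nonempty) (hS₁ : ∀ A, 0 ≤ S₁ A) (h : ∀ A, S₁ A ≤ S₂ A) :
    blockSpin Q S₁ B ≤ blockSpin Q S₂ B :=
  le_blockSpin hne fun A hA => (blockSpin_le hS₁ hA).trans (h A)

/-- a minimiser realises the block-spin value. [folklore] -/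
theorem blockSpin_eq_of_isMin (hS : ∀ A, 0 ≤ S A) {A₀ : V} (hA₀ : Q A₀ = B) (hmin : ∀ A, Q A = B → S A₀ ≤ S A) :
    blockSpin Q S B = S A₀ :=
  le_antisymm (blockSpin_le hS hA₀) (le_blockSpin ⟨A₀, hA₀⟩ hmin)

end basic

/-! ## §2 The composition law on actions: `T_{Q_k ∘ Q} S = T_{Q_k} (T_Q S)` -/

section comp

variable {Qk : W → Z} {Q₁ : V → W} {S : V → ℝ} {B : Z}

/-- **COMPOSITION LAW FOR MINIMUM VALUES**: iterated constrained minimisation = minimisation under the composed constraint,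
`T_{Q_k∘Q₁} S (B) = T_{Q_k} (T_{Q₁} S) (B)` (for a nonnegative action and a surjective inner average).  With
[Balaban1984PropagatorsI] (1.16)–(1.18) `Q_{k+1} = Q_k ∘ Q` (tree `B5Composition116`) this reads `Δ_{k+1} = T_{Q_k}(S¹)`,
`S¹ = T_Q S_{η/L}` the one-step effective action on η-lattice fields. [folklore] -/
theorem blockSpin_comp (hQ₁ : Function.Surjective Q₁) (hS : ∀ A, 0 ≤ S A) :
    blockSpin (Qk ∘ Q₁) S B = blockSpin Qk (blockSpin Q₁ S) B := by
  have hT : ∀ A₁, 0 ≤ blockSpin Q₁ S A₁ := fun A₁ => blockSpin_nonneg' hS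
  refine le_antisymm ?_ ?_
  · -- `T_{Qk∘Q₁} S B ≤ T_{Q₁} S A₁` for every `A₁` in the `Qk`-fibre, hence `≤` the infimum
    by_cases hne : (fib Qk B).Nonempty
    · refine le_blockSpin hne fun A₁ hA₁ => ?_
      obtain ⟨A, hA⟩ := hQ₁ A₁
      refine le_blockSpin ⟨A, by simp [fib, hA]⟩ fun A' hA' => ?_
      exact blockSpin_le hS (show (Qk ∘ Q₁) A' = B by simp [hA', hA₁])
    · rw [Set.not_nonempty_iff_eq_empty] at hne
      have hne' : fib (Qk ∘ Q₁) B = ∅ := by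
        ext A
        simp only [mem_fib, Function.comp_apply, Set.mem_empty_iff_false, iff_false]
        intro h
        have : Q₁ A ∈ fib Qk B := h
        simp [hne] at this
      simp [blockSpin, hne, hne']
  · -- every `A` in the composite fibre has `Q₁ A` in the `Qk`-fibre
    by_cases hne : (fib (Qk ∘ Q₁) B).Nonempty
    · refine le_blockSpin hne fun A hA => ?_
      exact (blockSpin_le hT (A := Q₁ A) hA).trans (blockSpin_le hS rfl)
    · rw [Set.not_nonempty_iff_eq_empty] at hne
      have hne' : fib Qk B = ∅ := by
        ext A₁
        simp only [mem_fib, Set.mem_empty_iff_false, iff_false]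
        intro h
        obtain ⟨A, hA⟩ := hQ₁ A₁
        have : A ∈ fib (Qk ∘ Q₁) B := by simp [fib, hA, h]
        simp [hne] at this
      simp [blockSpin, hne, hne']

end comp

/-! ## §3 The two transfer inequalities and the one-step sandwich -/

section transfer

/-- **FEDERBUSH LOWER TRANSFER** (with an approximate factor `1 + μ`; `μ = 0` at `U = 1`): if averaging decreases the
action up to the factor, `S⁰ (Q₁ A′) ≤ (1 + μ)·S_f A′` for every fine field `A′`, then `T_{Q_k} S⁰ ≤ (1 + μ)·T_{Q_k∘Q₁} S_f`,
i.e. `Δ_k ≤ (1 + μ) Δ_{k+1}`.  At `U = 1` the hypothesis with `μ = 0` is Federbush's Abelian Stability Theorem «averaging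
decreases the action» for Bałaban's (1.18) average, IN THE TREE with constant exactly 1
(`B5AverageCurlStokes.sum_normSq_Fs_QvOp_le`). [cite: Federbush1986PhaseCellI, (0.12) p.321] -/
theorem blockSpin_federbush_lower {Qk : W → Z} {Q₁ : V → W} {B : Z} {S0 : W → ℝ} {Sf : V → ℝ} {μ : ℝ}
    (hμ : 0 ≤ μ) (hS0 : ∀ A₁, 0 ≤ S0 A₁) (hne : (fib (Qk ∘ Q₁) B).Nonempty)
    (hF : ∀ A', S0 (Q₁ A') ≤ (1 + μ) * Sf A') :
    blockSpin Qk S0 B ≤ (1 + μ) * blockSpin (Qk ∘ Q₁) Sf B := by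
  have h1 : 0 < 1 + μ := by linarith
  have key : blockSpin Qk S0 B / (1 + μ) ≤ blockSpin (Qk ∘ Q₁) Sf B := by
    refine le_blockSpin hne fun A' hA' => ?_
    rw [div_le_iff₀ h1]
    calc blockSpin Qk S0 B ≤ S0 (Q₁ A') := blockSpin_le hS0 (A := Q₁ A') hA'
      _ ≤ (1 + μ) * Sf A' := hF A'
      _ = Sf A' * (1 + μ) := mul_comm _ _
  rwa [div_le_iff₀ h1, mul_comm] at key

/-- **UPPER TRANSFER FROM ONE-STEP CONSISTENCY ON THE MINIMISER ONLY**: if `A₀` minimises `S⁰` on the `Q`-fibre of `B` and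
`S¹ A₀ ≤ (1 + ε)·S⁰ A₀`, then `T_Q S¹ (B) ≤ (1 + ε)·T_Q S⁰ (B)`.  (No comparison of `S¹` with `S⁰` on lattice-scale fields is
needed — the source of the CONTRACTION.) [folklore] -/
theorem blockSpin_transfer_upper {Q : V → W} {S0 S1 : V → ℝ} {B : W} {ε : ℝ} (hS1 : ∀ A, 0 ≤ S1 A)
    (hS0 : ∀ A, 0 ≤ S0 A) {A₀ : V} (hA₀ : Q A₀ = B) (hmin : ∀ A, Q A = B → S0 A₀ ≤ S0 A)
    (hc : S1 A₀ ≤ (1 + ε) * S0 A₀) :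
    blockSpin Q S1 B ≤ (1 + ε) * blockSpin Q S0 B := by
  rw [blockSpin_eq_of_isMin hS0 hA₀ hmin]
  exact (blockSpin_le hS1 hA₀).trans hc

/-- **THE ONE-STEP SANDWICH** (assembly of the route at one level `k`): for the k-fold average `Q_k : W → Z`, the one-step
average `Q₁ : V → W` (fine `V` = η/L-lattice fields, `W` = η-lattice fields, `Z` = unit-lattice fields), the η-lattice action
`S⁰` and the fine action `S_f`:
(Federbush, factor `1 + μ`) ∧ (`A₀` = the k-step minimiser of `S⁰` over `B`) ∧ (one-step consistency on `A₀`: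
`T_{Q₁} S_f (A₀) ≤ (1 + ε)·S⁰ A₀`) ⟹ `Δ_k(B) ≤ (1 + μ)·Δ_{k+1}(B)` and `Δ_{k+1}(B) ≤ (1 + ε)·Δ_k(B)`,
where `Δ_k := T_{Q_k} S⁰`, `Δ_{k+1} := T_{Q_k∘Q₁} S_f` (composition law [Balaban1984PropagatorsI] (1.16)–(1.18)). [folklore] -/
theorem step_sandwich {Qk : W → Z} {Q₁ : V → W} {S0 : W → ℝ} {Sf : V → ℝ} {B : Z} {ε μ : ℝ}
    (hQ₁ : Function.Surjective Q₁) (hS0 : ∀ A₁, 0 ≤ S0 A₁) (hSf : ∀ A', 0 ≤ Sf A') (hμ : 0 ≤ μ)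
    (hF : ∀ A', S0 (Q₁ A') ≤ (1 + μ) * Sf A')
    {A₀ : W} (hA₀ : Qk A₀ = B) (hmin : ∀ A₁, Qk A₁ = B → S0 A₀ ≤ S0 A₁)
    (hc : blockSpin Q₁ Sf A₀ ≤ (1 + ε) * S0 A₀) :
    blockSpin Qk S0 B ≤ (1 + μ) * blockSpin (Qk ∘ Q₁) Sf B ∧
      blockSpin (Qk ∘ Q₁) Sf B ≤ (1 + ε) * blockSpin Qk S0 B := by
  refine ⟨blockSpin_federbush_lower hμ hS0 ?_ hF, ?_⟩
  · obtain ⟨A', hA'⟩ := hQ₁ A₀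
    exact ⟨A', by simp [fib, hA', hA₀]⟩
  · rw [blockSpin_comp hQ₁ hSf]
    exact blockSpin_transfer_upper (fun _ => blockSpin_nonneg' hSf) hS0 hA₀ hmin hc

/-- **RATE FORM at `U = 1`** (`μ = 0`): `0 ≤ Δ_{k+1}(B) − Δ_k(B) ≤ ε·Δ_k(B)` — the form-relative η-rate of the effective
action at one level, from exact Federbush monotonicity and one-step consistency on the minimiser. [folklore] -/
theorem step_rate {Qk : W → Z} {Q₁ : V → W} {S0 : W → ℝ} {Sf : V → ℝ} {B : Z} {ε : ℝ}
    (hQ₁ : Function.Surjective Q₁) (hS0 : ∀ A₁, 0 ≤ S0 A₁) (hSf : ∀ A', 0 ≤ Sf A')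
    (hF : ∀ A', S0 (Q₁ A') ≤ Sf A')
    {A₀ : W} (hA₀ : Qk A₀ = B) (hmin : ∀ A₁, Qk A₁ = B → S0 A₀ ≤ S0 A₁)
    (hc : blockSpin Q₁ Sf A₀ ≤ (1 + ε) * S0 A₀) :
    0 ≤ blockSpin (Qk ∘ Q₁) Sf B - blockSpin Qk S0 B ∧
      blockSpin (Qk ∘ Q₁) Sf B - blockSpin Qk S0 B ≤ ε * blockSpin Qk S0 B := by
  obtain ⟨h₁, h₂⟩ := step_sandwich (μ := 0) hQ₁ hS0 hSf le_rfl (by simpa using hF) hA₀ hmin hc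
  constructor <;> linarith

end transfer

/-! ## §4 `U = 1` WIRING on the torus: every hypothesis of `step_rate` except ONE-STEP CONSISTENCY is a tree theorem

Fine torus of level `k`: `Tor (fine n M)` (`n = L^k`, `η = n⁻¹`); of level `k + 1`: `Tor (fine L (fine n M))` (the tree's
second name of `Tor (fine (n·L) M)`, `B5Composition116.sites`); unit torus `Tor M`.  Forms in B5's PHYSICAL normalisation
(1.21): `Sphys n M A = η^d·½Σ|F|² = n^{−d}·cEnergy n M A`; averages `QvOp` of (1.18); `H_k = HkOp` of (1.63). -/

section wiring

open scoped Matrix ComplexConjugate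
open Literature.MathematicalPhysics.QuantumFieldTheory.Balaban1983to89
open Literature.MathematicalPhysics.QuantumFieldTheory.Balaban1983to89.B5Prop11Plancherel (Tor fine)
open Literature.MathematicalPhysics.QuantumFieldTheory.Balaban1983to89.B5Action121 (Fs)
open Literature.MathematicalPhysics.QuantumFieldTheory.Balaban1983to89.B5Block118 (QvOp)
open Literature.MathematicalPhysics.QuantumFieldTheory.Balaban1983to89.B5Hk163Torus (HkOp QvOp_HkOp_mulVec)
open Literature.MathematicalPhysics.QuantumFieldTheory.Balaban1983to89.B5Hk163RDiv (HkOp_minimum)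
open Literature.MathematicalPhysics.QuantumFieldTheory.Balaban1983to89.B5Hk164Transl (cEnergy cEnergy_eq cEnergy_nonneg)
open Literature.MathematicalPhysics.QuantumFieldTheory.Balaban1983to89.B5AverageCurlStokes (plaq Fs_eq_mul_plaq
  sum_normSq_plaq_QvOp_le)

variable {d : ℕ} (n L : ℕ) [NeZero n] [NeZero L] (M : Fin d → ℕ) [hM : ∀ μ, NeZero (M μ)]

/-- B5's action (1.21) in PHYSICAL units at spacing `η = n⁻¹`: `⟨∂A, ∂A⟩_η = ½Σ_{x,μ,ν} η^d |F_{μν}(x)|² = n^{−d}·cEnergy n M A`.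
[cite: Balaban1984PropagatorsI, (1.21) p.21 + (1.47) p.26] -/
noncomputable def Sphys (A : Tor (fine n M) × Fin d → ℂ) : ℝ := ((n : ℝ) ^ d)⁻¹ * cEnergy n M A

/-- the same physical action one level finer (`η′ = (nL)⁻¹`), for fields on `Tor (fine L (fine n M))`; the tree's
`cEnergy L (fine n M)` carries the lattice factor `L` only, so `F^{(η′)} = n·F^{(L)}` and
`⟨∂A′, ∂A′⟩_{η′} = (nL)^{−d}·n²·cEnergy L (fine n M) A′`. [cite: Balaban1984PropagatorsI, (1.21) p.21] -/
noncomputable def Sfine (A' : Tor (fine L (fine n M)) × Fin d → ℂ) : ℝ :=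
  (((n : ℝ) * L) ^ d)⁻¹ * (n : ℝ) ^ 2 * cEnergy L (fine n M) A'

/-- `cEnergy` through the plaquette sums: `cEnergy n M A = ½·n²·Σ_{μ,ν,x} |plaq A μ ν x|²`. [folklore] -/
theorem cEnergy_eq_plaq (A : Tor (fine n M) × Fin d → ℂ) :
    cEnergy n M A = (1 / 2 : ℝ) * ((n : ℝ) ^ 2 * ∑ μ, ∑ ν, ∑ x, ‖plaq (fine n M) A μ ν x‖ ^ 2) := by
  rw [cEnergy_eq]
  congr 1
  simp_rw [Fs_eq_mul_plaq, norm_mul, Complex.norm_natCast, mul_pow, Finset.mul_sum]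
  rw [Finset.sum_comm]
  refine Finset.sum_congr rfl fun μ _ => ?_
  rw [Finset.sum_comm]

/-- the physical actions are nonnegative. [folklore] -/
theorem Sphys_nonneg (A : Tor (fine n M) × Fin d → ℂ) : 0 ≤ Sphys n M A :=
  mul_nonneg (by positivity) (cEnergy_nonneg n M A)

/-- the fine physical action is nonnegative. [folklore] -/
theorem Sfine_nonneg (A' : Tor (fine L (fine n M)) × Fin d → ℂ) : 0 ≤ Sfine n L M A' :=
  mul_nonneg (mul_nonneg (by positivity) (by positivity)) (cEnergy_nonneg L (fine n M) A')

/-- **FEDERBUSH FOR ONE STEP, PHYSICAL UNITS, CONSTANT EXACTLY 1**: `⟨∂(Q A′), ∂(Q A′)⟩_η ≤ ⟨∂A′, ∂A′⟩_{η/L}` — the tree's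
`B5AverageCurlStokes.sum_normSq_plaq_QvOp_le` (Abelian Stability Theorem) at block side `L` over the torus `fine n M`.
[cite: Federbush1986PhaseCellI, (0.12) p.321] -/
theorem federbush_oneStep (A' : Tor (fine L (fine n M)) × Fin d → ℂ) :
    Sphys n M (QvOp L (fine n M) *ᵥ A') ≤ Sfine n L M A' := by
  unfold Sphys Sfine
  rw [cEnergy_eq_plaq, cEnergy_eq_plaq]
  have hn : (0 : ℝ) < n := by exact_mod_cast Nat.pos_of_ne_zero (NeZero.ne n)
  have hL : (0 : ℝ) < L := by exact_mod_cast Nat.pos_of_ne_zero (NeZero.ne L)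
  have key : ∀ μ ν : Fin d, ∑ y, ‖plaq (fine n M) (QvOp L (fine n M) *ᵥ A') μ ν y‖ ^ 2
      ≤ ((L : ℝ) ^ d)⁻¹ * (L : ℝ) ^ 2 * ∑ x, ‖plaq (fine L (fine n M)) A' μ ν x‖ ^ 2 := by
    intro μ ν
    have h := sum_normSq_plaq_QvOp_le L (fine n M) A' μ ν
    have hLd : (0 : ℝ) < (L : ℝ) ^ d := by positivity
    rw [mul_assoc, le_inv_mul_iff₀ hLd]
    exact h
  have hsum : ∑ μ, ∑ ν, ∑ y, ‖plaq (fine n M) (QvOp L (fine n M) *ᵥ A') μ ν y‖ ^ 2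
      ≤ ((L : ℝ) ^ d)⁻¹ * (L : ℝ) ^ 2 * ∑ μ, ∑ ν, ∑ x, ‖plaq (fine L (fine n M)) A' μ ν x‖ ^ 2 := by
    rw [Finset.mul_sum]
    refine Finset.sum_le_sum fun μ _ => ?_
    rw [Finset.mul_sum]
    exact Finset.sum_le_sum fun ν _ => key μ ν
  have hnd : (0 : ℝ) < (n : ℝ) ^ d := by positivity
  calc ((n : ℝ) ^ d)⁻¹ * (1 / 2 * ((n : ℝ) ^ 2 * ∑ μ, ∑ ν, ∑ y, ‖plaq (fine n M) (QvOp L (fine n M) *ᵥ A') μ ν y‖ ^ 2))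
      ≤ ((n : ℝ) ^ d)⁻¹ * (1 / 2 * ((n : ℝ) ^ 2 *
          (((L : ℝ) ^ d)⁻¹ * (L : ℝ) ^ 2 * ∑ μ, ∑ ν, ∑ x, ‖plaq (fine L (fine n M)) A' μ ν x‖ ^ 2))) := by
        gcongr
    _ = (((n : ℝ) * L) ^ d)⁻¹ * (n : ℝ) ^ 2 *
          (1 / 2 * ((L : ℝ) ^ 2 * ∑ μ, ∑ ν, ∑ x, ‖plaq (fine L (fine n M)) A' μ ν x‖ ^ 2)) := by
        rw [mul_pow]
        field_simp

/-- the one-step average is onto (right inverse = the one-step minimiser `H` of (1.63)). [folklore] -/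
theorem QvOp_surjective : Function.Surjective fun A' : Tor (fine L (fine n M)) × Fin d → ℂ => QvOp L (fine n M) *ᵥ A' :=
  fun A => ⟨HkOp L (fine n M) *ᵥ A, QvOp_HkOp_mulVec L (fine n M) A⟩

/-- **THE k-STEP EFFECTIVE ACTION AS A MINIMUM VALUE** in physical units: `Δ_k(B) := inf {⟨∂A, ∂A⟩_η : Q_k A = B}`.
[cite: Balaban1984PropagatorsI, p.26 (text before (1.48)) + (1.65) p.29] -/
noncomputable def effAction (B : Tor M × Fin d → ℂ) : ℝ := blockSpin (fun A => QvOp n M *ᵥ A) (Sphys n M) B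

/-- **THE (k+1)-STEP EFFECTIVE ACTION** through the COMPOSED average `Q_k ∘ Q` on the finer torus:
`Δ_{k+1}(B) := inf {⟨∂A′, ∂A′⟩_{η/L} : Q_k (Q A′) = B}` (= the (k+1)-fold problem by the composition law
`B5Composition116.QvOp_comp`). [cite: Balaban1984PropagatorsI, (1.16)–(1.18) p.20] -/
noncomputable def effActionSucc (B : Tor M × Fin d → ℂ) : ℝ :=
  blockSpin ((fun A => QvOp n M *ᵥ A) ∘ fun A' : Tor (fine L (fine n M)) × Fin d → ℂ => QvOp L (fine n M) *ᵥ A')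
    (Sfine n L M) B

/-- **THE ONE-STEP EFFECTIVE ACTION** on η-lattice fields: `S¹(A) := inf {⟨∂A′, ∂A′⟩_{η/L} : Q A′ = A}`. [folklore] -/
noncomputable def oneStepAction (A : Tor (fine n M) × Fin d → ℂ) : ℝ :=
  blockSpin (fun A' : Tor (fine L (fine n M)) × Fin d → ℂ => QvOp L (fine n M) *ᵥ A') (Sfine n L M) A

/-- (1.65) for the minimum value: `Δ_k(B) = ⟨∂H_kB, ∂H_kB⟩_η` — the infimum is attained at the tree's (1.63) operator
(`B5Hk163RDiv.HkOp_minimum`, `B5Hk163Torus.QvOp_HkOp_mulVec`). [cite: Balaban1984PropagatorsI, (1.65) p.29] -/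
theorem effAction_eq (B : Tor M × Fin d → ℂ) : effAction n M B = Sphys n M (HkOp n M *ᵥ B) :=
  blockSpin_eq_of_isMin (Sphys_nonneg n M) (QvOp_HkOp_mulVec n M B) fun A hA =>
    mul_le_mul_of_nonneg_left (HkOp_minimum n M B A hA) (by positivity)

/-- **MONOTONICITY IN k**: `Δ_k(B) ≤ Δ_{k+1}(B)` for EVERY `B`, every torus, every `n, L ≥ 1` — exact, from Federbush's
theorem; hypothesis-free. [folklore] -/
theorem effAction_le_succ (B : Tor M × Fin d → ℂ) : effAction n M B ≤ effActionSucc n L M B := by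
  have h := blockSpin_federbush_lower (Qk := fun A => QvOp n M *ᵥ A)
    (Q₁ := fun A' : Tor (fine L (fine n M)) × Fin d → ℂ => QvOp L (fine n M) *ᵥ A') (B := B) (μ := 0) le_rfl
    (Sphys_nonneg n M) ?_ (fun A' => by simpa using federbush_oneStep n L M A')
  · simpa [effAction, effActionSucc] using h
  · obtain ⟨A', hA'⟩ := QvOp_surjective n L M (HkOp n M *ᵥ B)
    refine ⟨A', ?_⟩
    show QvOp n M *ᵥ (QvOp L (fine n M) *ᵥ A') = B
    have hA'' : QvOp L (fine n M) *ᵥ A' = HkOp n M *ᵥ B := hA'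
    rw [hA'', QvOp_HkOp_mulVec]

/-- **THE FORM-LEVEL η-RATE OF THE EFFECTIVE ACTION AT ONE LEVEL ⇐ ONE-STEP CONSISTENCY ON THE MINIMISER** (`U = 1`,
every torus, every `n, L ≥ 1`, every `B`): if the one-step effective action of the k-step minimiser exceeds its Wilson action by
at most the factor `1 + ε`, then `0 ≤ Δ_{k+1}(B) − Δ_k(B) ≤ ε·Δ_k(B)`.  Every other input (composition, monotonicity, Federbush,
minimality of `H_k`) is a tree theorem; `hc` is the route's typed leaf (sibling module `VariationalLeaves`: one-step symbol
inequality × L²-regularity of `H_kB`, `ε = C·n^{−2}`). [folklore] -/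
theorem effAction_step_rate (B : Tor M × Fin d → ℂ) {ε : ℝ}
    (hc : oneStepAction n L M (HkOp n M *ᵥ B) ≤ (1 + ε) * Sphys n M (HkOp n M *ᵥ B)) :
    0 ≤ effActionSucc n L M B - effAction n M B ∧
      effActionSucc n L M B - effAction n M B ≤ ε * effAction n M B := by
  have h := step_rate (Qk := fun A => QvOp n M *ᵥ A)
    (Q₁ := fun A' : Tor (fine L (fine n M)) × Fin d → ℂ => QvOp L (fine n M) *ᵥ A') (B := B)
    (QvOp_surjective n L M) (Sphys_nonneg n M) (Sfine_nonneg n L M)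
    (fun A' => federbush_oneStep n L M A') (QvOp_HkOp_mulVec n M B)
    (fun A hA => mul_le_mul_of_nonneg_left (HkOp_minimum n M B A hA) (by positivity)) hc
  simpa [effAction, effActionSucc] using h

end wiring

end Summit.QuantumFields.BalabanUV.T4Continuum.VariationalTransfer
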